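import Literature.AlgebraicGeometry.Motives.GaloisThickening          -- ★ `thickeningLift e X P = (P, Spec e)` (`thickeningLift_left_comp_fst∕snd`)
import Literature.AlgebraicGeometry.Motives.JacobianGaloisDescent     -- ★ `GaloisDescent.gal L X σ = 1 × Spec σ⁻¹` (`gal_fst`, `gal_snd`)
import HarnessLib

/-!
# The sheet lift `ℓ_e` and the Galois twist of the base: `ℓ_{e∘γ}(P) = ℓ_e(P) ≫ (1 × Spec γ)`

Topic `AlgebraicGeometry/Motives`; namespace `Literature.AlgebraicGeometry.Motives`.  THEOREMS ONLY (no definition, no named fact, no instance, no notation,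
no `sorry`); universe-monomorphic in `u` like ★ `GaloisThickening`.  Cell `hodgecm-mathlib` (D-0151), P6 «MOD programme» (crux hLiu418 = stmt-HodgeConjecture-24832,
`--supports`, count-neutral), line «L4», ROAD OF RECORD (γ′) (LA4-plan (g2) 2026-09-02 08:48:23Z ∕ DEAL #39): the SHEET LAW used to re-index the twisted family
`P ×_X (1 × Spec γ)` at the sheet point `ℓ_{τE}(z)` as the family `P` at the sheet point `ℓ_{τE∘γ}(z)`.

THE MATHEMATICS ([GortzWedhorn2020] §(4.8)–(4.9), Prop. 4.16: morphisms into a fibre product are pairs; [Milne1986JacobianVarieties] §6 ∕ folklore Galois twist of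
`X ⊗_K L` by `σ ∈ Aut(L∕K)`).  For a `K`-scheme `X`, a `K`-algebra map `e : L → Ω` into a field and an `Ω`-point `P` of `X`, the sheet lift `ℓ_e(P) = (P, Spec e) :
Spec Ω → X ⊗_K L` (★ `thickeningLift`); the twist `gal σ = 1 × Spec σ⁻¹ : X ⊗_K L → X ⊗_K L` (★ `GaloisDescent.gal`).  Then `ℓ_e(P) ≫ gal γ⁻¹ = (P, Spec e ≫ Spec γ) =
(P, Spec (e ∘ γ)) = ℓ_{e∘γ}(P)` — both components agree (`pullback.hom_ext`).

CONTENTS: `thickeningLift_comp_algEquiv_left` (`(ℓ_{e∘γ} P).left = (ℓ_e P).left ≫ gal L X γ⁻¹`), `thickeningLift_left_comp_gal` (`(ℓ_e P).left ≫ gal L X γ =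
(ℓ_{e∘γ⁻¹} P).left`).  USE: Lines `F0P6aGlobalSheetRows.coverKerBody_sheet_of_global_rows∕_rel` (LA4-p01 (g3)), LEG-E(γ′) (LA7-p01 (g4)).

References (metadata in `HarnessLib/References.lean`):
* [GortzWedhorn2020] U. Görtz, T. Wedhorn, *Algebraic Geometry I*, 2nd ed. (2020), §(4.8)–(4.9) (pp. 109–111), Prop. 4.16 (p. 101).
* [Milne1986JacobianVarieties] J. S. Milne, *Jacobian varieties*, in: Arithmetic Geometry (Cornell, Silverman eds.), Springer (1986), §6 (Galois descent, proof of Prop. 6.4).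
-/

set_option autoImplicit false

noncomputable section

-- Mathlib's `Over`/pull-back API is stated across semireducible wrappers (`bcSpec`, `Over.left (thickening …)`), as in ★ `GaloisThickening`.
set_option backward.isDefEq.respectTransparency false

open CategoryTheory AlgebraicGeometry Limits

universe u

namespace Literature.AlgebraicGeometry.Motives

open Literature.AlgebraicGeometry.Motives.AbelianVariety (bcSpec specAut)

variable {K : Type u} [Field K] {L : Type u} [Field L] [Algebra K L] {Ω : Type u} [Field Ω] [Algebra K Ω]
  (e : L →ₐ[K] Ω) (γ : L ≃ₐ[K] L) (X : SchemeOver K) (P : AlgPoints X Ω)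

/-- **`ℓ_{e∘γ}(P) = ℓ_e(P) ≫ (1 × Spec γ)`** (underlying morphisms `Spec Ω → X ⊗_K L`; `1 × Spec γ = gal γ⁻¹`): both have first component `P` (★
`thickeningLift_left_comp_fst`, ★ `gal_fst`) and second component `Spec (e ∘ γ) = Spec e ≫ Spec γ` (★ `thickeningLift_left_comp_snd`, ★ `gal_snd`,
contravariance of `Spec`). [cite: GortzWedhorn2020, §(4.8)–(4.9) (pp. 109–111) and Prop. 4.16 (p. 101)] [cite: Milne1986JacobianVarieties, §6 Prop. 6.4 (proof)] -/
theorem thickeningLift_comp_algEquiv_left :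
    (thickeningLift (e.comp (γ : L →ₐ[K] L)) X P).left = (thickeningLift e X P).left ≫ GaloisDescent.gal L X γ⁻¹ := by
  apply pullback.hom_ext
  · rw [Category.assoc, GaloisDescent.gal_fst, thickeningLift_left_comp_fst, thickeningLift_left_comp_fst]
  · rw [Category.assoc, GaloisDescent.gal_snd, thickeningLift_left_comp_snd_assoc, thickeningLift_left_comp_snd, inv_inv, ← Spec.map_comp]
    rfl

/-- **`ℓ_e(P) ≫ gal γ = ℓ_{e∘γ⁻¹}(P)`** (the same with `γ⁻¹`; `gal γ = 1 × Spec γ⁻¹`). [cite: GortzWedhorn2020, §(4.8)–(4.9) (pp. 109–111) and Prop. 4.16 (p. 101)]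
[cite: Milne1986JacobianVarieties, §6 Prop. 6.4 (proof)] -/
theorem thickeningLift_left_comp_gal :
    (thickeningLift e X P).left ≫ GaloisDescent.gal L X γ = (thickeningLift (e.comp ((γ⁻¹ : L ≃ₐ[K] L) : L →ₐ[K] L)) X P).left := by
  rw [thickeningLift_comp_algEquiv_left, inv_inv]

end Literature.AlgebraicGeometry.Motives

end
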